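import Literature.RingTheory.Flat.AmitsurDescentData
import Literature.AlgebraicGeometry.Modules.CechBaseChangeHom
import Literature.AlgebraicGeometry.Modules.IsoOfSectionsOnBasis
import Mathlib.AlgebraicGeometry.Morphisms.Flat
import HarnessLib

/-!
# Sections of a quasi-coherent module form an fpqc sheaf, I: the affine chart

Topic `Literature/AlgebraicGeometry/Morphisms`, namespace `Literature.AlgebraicGeometry.Morphisms`.  THEOREMS ONLY; no definition, no
named fact, no instance, no notation, no `sorry`.

[SGA1] Exp. VIII Thm. 1.1, Cor. 1.2 / [StacksProject, Tag 023M] / [GortzWedhorn2020] Thm. 14.66: for an fpqc covering `g : Z → X` and a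
quasi-coherent `𝒪_X`-module `M`, the sections of `M` are the equaliser of the two pull-backs `p₁^*, p₂^*` of sections of `g^*M` to the
kernel pair `p₁, p₂ : Z ×_X Z ⇉ Z`.  This file is the AFFINE CHART of that statement, for `g` flat and surjective, the kernel pair given
by ANY cartesian square `IsPullback p₁ p₂ g g`, and an affine open `V ⊆ X` with `U = g⁻¹V` and `U₂ = p₁⁻¹U ∩ p₂⁻¹U` affine:

* the two COFACES `s ↦ p₁^*s|_{U₂}`, `s ↦ p₂^*s|_{U₂}` `: Γ(g⁻¹V, g^*M) → Γ(U₂, (p₁ ≫ g)^*M)` (spelled with Mathlib's `pullbackComp` /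
  `pullbackCongr` on unit sections `η`, the second read in `(p₁ ≫ g)^*M`) commute with restriction to `W ⊆ V` (`cofaceFst_map`,
  `cofaceSnd_map`) and agree on pulled-back sections (`cofaceFst_unitSection`, `cofaceSnd_unitSection` — both give `η_{p₁ ≫ g}(m)|_{U₂}`);
* `Γ(V) → Γ(U)` is faithfully flat (`faithfullyFlat_appLE`: Mathlib `Flat.flat_appLE` + surjectivity read through `fromSpec`);
  `Γ(U₂) = Γ(U) ⊗_{Γ(V)} Γ(U)` through `p₁^♯, p₂^♯` (`exists_ringEquiv_tensorProduct_kernelPair`: Mathlib `isIso_pushoutSection_of_isAffineOpen`);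
  `Γ(U, g^*M)`, `Γ(U₂, (p₁ ≫ g)^*M)` are the base changes of `Γ(V, M)` (★ `Modules/CechBaseChangeHom.isBaseChange_unitSectionLE`);
* hence, by Amitsur's degree-zero exactness in base-change-data form (★ `RingTheory/Flat/AmitsurDescentData`):
  **`unitSection_injective_of_affine`** (`η : Γ(V, M) → Γ(g⁻¹V, g^*M)` is injective) and **`existsUnique_unitSection_eq_of_affine`** (a
  section of `g^*M` over `g⁻¹V` whose two cofaces agree is `η(m)` for a unique `m ∈ Γ(V, M)`).

The gluing over all opens of `X` (for `g` affine) is `Morphisms/SectionsFpqcDescent`.  HC_CM is proved only modulo the 7 printed citations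
until rung 0 closes; nothing here is about HC.

## References
* [SGA1] A. Grothendieck, *SGA 1*, Exp. VIII §1, Thm. 1.1, Cor. 1.2.
* [StacksProject] The Stacks Project, Tag 023M (Descent, Lemma 35.3.6).
* [GortzWedhorn2020] U. Görtz, T. Wedhorn, *Algebraic Geometry I*, 2nd ed. (2020), Thm. 14.66, Prop. 14.68.
-/

noncomputable section

-- `TopCat.Presheaf`/`Scheme.Modules` are not reducible (as in Mathlib's `AlgebraicGeometry/Modules`).
set_option backward.isDefEq.respectTransparency false

universe u

open CategoryTheory CategoryTheory.Limits AlgebraicGeometry TopologicalSpace Opposite TensorProduct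

namespace Literature.AlgebraicGeometry.Morphisms

open Literature.AlgebraicGeometry.Modules Literature.RingTheory.Flat

variable {X Z Z₂ : Scheme.{u}} (g : Z ⟶ X) (p₁ p₂ : Z₂ ⟶ Z) (M : X.Modules)

/-! ### §1 The affine chart -/

section Chart

variable {V : X.Opens}

/-- **`Γ(V) → Γ(g⁻¹V)` is faithfully flat** for `g` flat and surjective and affine `V`, `g⁻¹V` (flat: Mathlib `Flat.flat_appLE`;
surjective on spectra: `Spec Γ(g⁻¹V) → Spec Γ(V)` is `g` read through the charts `fromSpec`, Mathlib
`IsAffineOpen.SpecMap_appLE_fromSpec`). [cite: GortzWedhorn2020, Prop. 14.68] [cite: StacksProject, Tag 023M] -/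
theorem faithfullyFlat_appLE [Flat g] [Surjective g] (hV : IsAffineOpen V) (hU : IsAffineOpen (g ⁻¹ᵁ V)) :
    (g.appLE V (g ⁻¹ᵁ V) le_rfl).hom.FaithfullyFlat := by
  rw [RingHom.FaithfullyFlat.iff_flat_and_comap_surjective]
  refine ⟨g.flat_appLE hV hU le_rfl, fun y => ?_⟩
  -- `hV.fromSpec y ∈ V` has a `g`-preimage `z`, which lies in `g⁻¹V = range hU.fromSpec`
  obtain ⟨z, hz⟩ := g.surjective (hV.fromSpec.base y)
  have hzU : z ∈ Set.range hU.fromSpec.base := by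
    rw [hU.range_fromSpec]
    change g.base z ∈ (V : Set X)
    rw [hz, ← hV.range_fromSpec]
    exact Set.mem_range_self y
  obtain ⟨w, rfl⟩ := hzU
  refine ⟨w, hV.fromSpec.isOpenEmbedding.injective ?_⟩
  have hsq := congrArg (fun φ => φ.base w) (IsAffineOpen.SpecMap_appLE_fromSpec g hV hU (le_rfl : g ⁻¹ᵁ V ≤ g ⁻¹ᵁ V))
  simp only [Scheme.Hom.comp_base, TopCat.coe_comp, Function.comp_apply] at hsq
  rw [← hz, ← hsq]
  rfl

/-- **`Γ(U₂) = Γ(U) ⊗_{Γ(V)} Γ(U)` through `p₁^♯`, `p₂^♯`** (`U = g⁻¹V`, `U₂ = p₁⁻¹U ∩ p₂⁻¹U`, `V`, `U` affine): there is a ring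
isomorphism `Γ(U) ⊗_{Γ(V)} Γ(U) ≅ Γ(U₂)` with `a ⊗ 1 ↦ p₁^♯ a` and `1 ⊗ b ↦ p₂^♯ b` (Mathlib `isIso_pushoutSection_of_isAffineOpen` for
the cartesian square `Z₂ ⇉ Z → X`, compared with the explicit pushout `CommRingCat.isPushout_tensorProduct`).
[cite: StacksProject, Tag 023M] -/
theorem exists_ringEquiv_tensorProduct_kernelPair (H₂ : IsPullback p₁ p₂ g g) (hV : IsAffineOpen V) (hU : IsAffineOpen (g ⁻¹ᵁ V)) :
    letI := (g.appLE V (g ⁻¹ᵁ V) le_rfl).hom.toAlgebra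
    ∃ e : Γ(Z, g ⁻¹ᵁ V) ⊗[Γ(X, V)] Γ(Z, g ⁻¹ᵁ V) ≃+* Γ(Z₂, p₁ ⁻¹ᵁ (g ⁻¹ᵁ V) ⊓ p₂ ⁻¹ᵁ (g ⁻¹ᵁ V)),
      (∀ a, e (a ⊗ₜ 1) = p₁.appLE (g ⁻¹ᵁ V) (p₁ ⁻¹ᵁ (g ⁻¹ᵁ V) ⊓ p₂ ⁻¹ᵁ (g ⁻¹ᵁ V)) inf_le_left a) ∧
      (∀ b, e (1 ⊗ₜ b) = p₂.appLE (g ⁻¹ᵁ V) (p₁ ⁻¹ᵁ (g ⁻¹ᵁ V) ⊓ p₂ ⁻¹ᵁ (g ⁻¹ᵁ V)) inf_le_right b) := by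
  letI := (g.appLE V (g ⁻¹ᵁ V) le_rfl).hom.toAlgebra
  have H := (isIso_pushoutSection_iff H₂ (le_rfl : g ⁻¹ᵁ V ≤ g ⁻¹ᵁ V) (le_rfl : g ⁻¹ᵁ V ≤ g ⁻¹ᵁ V)
    (rfl : p₁ ⁻¹ᵁ (g ⁻¹ᵁ V) ⊓ p₂ ⁻¹ᵁ (g ⁻¹ᵁ V) = p₁ ⁻¹ᵁ (g ⁻¹ᵁ V) ⊓ p₂ ⁻¹ᵁ (g ⁻¹ᵁ V))).mp
    (isIso_pushoutSection_of_isAffineOpen H₂ le_rfl le_rfl rfl hV hU hU)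
  let e := ((CommRingCat.isPushout_tensorProduct Γ(X, V) Γ(Z, g ⁻¹ᵁ V) Γ(Z, g ⁻¹ᵁ V)).isoIsPushout _ _ H)
  refine ⟨e.commRingCatIsoToRingEquiv, fun a => ?_, fun b => ?_⟩
  · have h := (CommRingCat.isPushout_tensorProduct Γ(X, V) Γ(Z, g ⁻¹ᵁ V) Γ(Z, g ⁻¹ᵁ V)).inl_isoIsPushout_hom _ _ H
    exact congr($(h).hom a)
  · have h := (CommRingCat.isPushout_tensorProduct Γ(X, V) Γ(Z, g ⁻¹ᵁ V) Γ(Z, g ⁻¹ᵁ V)).inr_isoIsPushout_hom _ _ H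
    exact congr($(h).hom b)


/-- `appLE` along equal morphisms (the proof slots are irrelevant). [folklore] -/
private theorem appLE_congr_hom_of_eq {Y : Scheme.{u}} {f₁ f₂ : Z₂ ⟶ Y} (h : f₁ = f₂) (U : Y.Opens) (W : Z₂.Opens)
    (e₁ : W ≤ f₁ ⁻¹ᵁ U) (e₂ : W ≤ f₂ ⁻¹ᵁ U) : f₁.appLE U W e₁ = f₂.appLE U W e₂ := by
  subst h
  rfl

/-- Restriction along `le_rfl` is the identity on sections. [folklore] -/
private theorem presheaf_map_le_rfl (N : Z.Modules) (W : Z.Opens) (x : Γ(N, W)) :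
    N.presheaf.map (homOfLE (le_refl W)).op x = x := by
  rw [Subsingleton.elim (homOfLE (le_refl W)) (𝟙 W), op_id, CategoryTheory.Functor.map_id]
  rfl

/-- **The first coface commutes with restriction**: for `W ⊆ V`, `p₁^*(s|_{g⁻¹W})|_{U₂(W)} = (p₁^*s|_{U₂(V)})|_{U₂(W)}`
(`U₂(V) = p₁⁻¹g⁻¹V ∩ p₂⁻¹g⁻¹V`). [cite: StacksProject, Tag 023M] -/
theorem cofaceFst_map {W : X.Opens} (k : W ≤ V) (s : Γ((Scheme.Modules.pullback g).obj M, g ⁻¹ᵁ V)) :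
    ((Scheme.Modules.pullback (p₁ ≫ g)).obj M).presheaf.map
        (homOfLE (inf_le_left : p₁ ⁻¹ᵁ (g ⁻¹ᵁ W) ⊓ p₂ ⁻¹ᵁ (g ⁻¹ᵁ W) ≤ p₁ ⁻¹ᵁ (g ⁻¹ᵁ W))).op
        (((Scheme.Modules.pullbackComp p₁ g).hom.app M).app (p₁ ⁻¹ᵁ (g ⁻¹ᵁ W))
          (unitSection p₁ ((Scheme.Modules.pullback g).obj M) (g ⁻¹ᵁ W)
            (((Scheme.Modules.pullback g).obj M).presheaf.map (homOfLE (g.preimage_mono k)).op s))) =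
      ((Scheme.Modules.pullback (p₁ ≫ g)).obj M).presheaf.map
        (homOfLE (inf_le_inf (p₁.preimage_mono (g.preimage_mono k)) (p₂.preimage_mono (g.preimage_mono k)))).op
        (((Scheme.Modules.pullback (p₁ ≫ g)).obj M).presheaf.map
          (homOfLE (inf_le_left : p₁ ⁻¹ᵁ (g ⁻¹ᵁ V) ⊓ p₂ ⁻¹ᵁ (g ⁻¹ᵁ V) ≤ p₁ ⁻¹ᵁ (g ⁻¹ᵁ V))).op
          (((Scheme.Modules.pullbackComp p₁ g).hom.app M).app (p₁ ⁻¹ᵁ (g ⁻¹ᵁ V))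
            (unitSection p₁ ((Scheme.Modules.pullback g).obj M) (g ⁻¹ᵁ V) s))) := by
  have nat := app_presheaf_map (M := (Scheme.Modules.pullback p₁).obj ((Scheme.Modules.pullback g).obj M))
    (N := (Scheme.Modules.pullback (p₁ ≫ g)).obj M) ((Scheme.Modules.pullbackComp p₁ g).hom.app M)
    ((Opens.map p₁.base).map (homOfLE (g.preimage_mono k))) (unitSection p₁ ((Scheme.Modules.pullback g).obj M) (g ⁻¹ᵁ V) s)
  rw [unitSection_map]
  erw [nat]
  conv_lhs => rw [← CategoryTheory.comp_apply, ← Functor.map_comp, ← op_comp]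
  conv_rhs => rw [← CategoryTheory.comp_apply, ← Functor.map_comp, ← op_comp]
  exact presheaf_map_congr _ _ _ _

/-- **The second coface commutes with restriction**: for `W ⊆ V`, `p₂^*(s|_{g⁻¹W})|_{U₂(W)} = (p₂^*s|_{U₂(V)})|_{U₂(W)}` (read in
`(p₁ ≫ g)^*M` through `pullbackCongr`). [cite: StacksProject, Tag 023M] -/
theorem cofaceSnd_map (H : p₂ ≫ g = p₁ ≫ g) {W : X.Opens} (k : W ≤ V) (s : Γ((Scheme.Modules.pullback g).obj M, g ⁻¹ᵁ V)) :
    ((Scheme.Modules.pullback (p₁ ≫ g)).obj M).presheaf.map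
        (homOfLE (inf_le_right : p₁ ⁻¹ᵁ (g ⁻¹ᵁ W) ⊓ p₂ ⁻¹ᵁ (g ⁻¹ᵁ W) ≤ p₂ ⁻¹ᵁ (g ⁻¹ᵁ W))).op
        (((Scheme.Modules.pullbackCongr H).hom.app M).app (p₂ ⁻¹ᵁ (g ⁻¹ᵁ W))
          (((Scheme.Modules.pullbackComp p₂ g).hom.app M).app (p₂ ⁻¹ᵁ (g ⁻¹ᵁ W))
            (unitSection p₂ ((Scheme.Modules.pullback g).obj M) (g ⁻¹ᵁ W)
              (((Scheme.Modules.pullback g).obj M).presheaf.map (homOfLE (g.preimage_mono k)).op s)))) =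
      ((Scheme.Modules.pullback (p₁ ≫ g)).obj M).presheaf.map
        (homOfLE (inf_le_inf (p₁.preimage_mono (g.preimage_mono k)) (p₂.preimage_mono (g.preimage_mono k)))).op
        (((Scheme.Modules.pullback (p₁ ≫ g)).obj M).presheaf.map
          (homOfLE (inf_le_right : p₁ ⁻¹ᵁ (g ⁻¹ᵁ V) ⊓ p₂ ⁻¹ᵁ (g ⁻¹ᵁ V) ≤ p₂ ⁻¹ᵁ (g ⁻¹ᵁ V))).op
          (((Scheme.Modules.pullbackCongr H).hom.app M).app (p₂ ⁻¹ᵁ (g ⁻¹ᵁ V))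
            (((Scheme.Modules.pullbackComp p₂ g).hom.app M).app (p₂ ⁻¹ᵁ (g ⁻¹ᵁ V))
              (unitSection p₂ ((Scheme.Modules.pullback g).obj M) (g ⁻¹ᵁ V) s)))) := by
  have nat := app_presheaf_map (M := (Scheme.Modules.pullback p₂).obj ((Scheme.Modules.pullback g).obj M))
    (N := (Scheme.Modules.pullback (p₂ ≫ g)).obj M) ((Scheme.Modules.pullbackComp p₂ g).hom.app M)
    ((Opens.map p₂.base).map (homOfLE (g.preimage_mono k))) (unitSection p₂ ((Scheme.Modules.pullback g).obj M) (g ⁻¹ᵁ V) s)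
  have nat' := app_presheaf_map (M := (Scheme.Modules.pullback (p₂ ≫ g)).obj M) (N := (Scheme.Modules.pullback (p₁ ≫ g)).obj M)
    ((Scheme.Modules.pullbackCongr H).hom.app M) ((Opens.map p₂.base).map (homOfLE (g.preimage_mono k)))
    (((Scheme.Modules.pullbackComp p₂ g).hom.app M).app (p₂ ⁻¹ᵁ (g ⁻¹ᵁ V))
      (unitSection p₂ ((Scheme.Modules.pullback g).obj M) (g ⁻¹ᵁ V) s))
  rw [unitSection_map]
  refine (congrArg (fun y => ((Scheme.Modules.pullback (p₁ ≫ g)).obj M).presheaf.map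
    (homOfLE (inf_le_right : p₁ ⁻¹ᵁ (g ⁻¹ᵁ W) ⊓ p₂ ⁻¹ᵁ (g ⁻¹ᵁ W) ≤ p₂ ⁻¹ᵁ (g ⁻¹ᵁ W))).op
    (((Scheme.Modules.pullbackCongr H).hom.app M).app (p₂ ⁻¹ᵁ (g ⁻¹ᵁ W)) y)) nat).trans ?_
  refine (congrArg (fun y => ((Scheme.Modules.pullback (p₁ ≫ g)).obj M).presheaf.map
    (homOfLE (inf_le_right : p₁ ⁻¹ᵁ (g ⁻¹ᵁ W) ⊓ p₂ ⁻¹ᵁ (g ⁻¹ᵁ W) ≤ p₂ ⁻¹ᵁ (g ⁻¹ᵁ W))).op y) nat').trans ?_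
  conv_lhs => rw [← CategoryTheory.comp_apply, ← Functor.map_comp, ← op_comp]
  conv_rhs => rw [← CategoryTheory.comp_apply, ← Functor.map_comp, ← op_comp]
  exact presheaf_map_congr _ _ _ _

/-- **The first coface of a pulled-back section**: `p₁^*(η_g(m))|_{U₂} = η_{p₁ ≫ g}(m)|_{U₂}` (Mathlib `pullbackComp` on unit sections,
★ `pullbackComp_hom_app_unitSection`). [cite: StacksProject, Tag 023M] -/
theorem cofaceFst_unitSection (m : Γ(M, V)) :
    ((Scheme.Modules.pullback (p₁ ≫ g)).obj M).presheaf.map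
        (homOfLE (inf_le_left : p₁ ⁻¹ᵁ (g ⁻¹ᵁ V) ⊓ p₂ ⁻¹ᵁ (g ⁻¹ᵁ V) ≤ p₁ ⁻¹ᵁ (g ⁻¹ᵁ V))).op
        (((Scheme.Modules.pullbackComp p₁ g).hom.app M).app (p₁ ⁻¹ᵁ (g ⁻¹ᵁ V))
          (unitSection p₁ ((Scheme.Modules.pullback g).obj M) (g ⁻¹ᵁ V) (unitSection g M V m))) =
      unitSectionLE (p₁ ≫ g) M (inf_le_left : p₁ ⁻¹ᵁ (g ⁻¹ᵁ V) ⊓ p₂ ⁻¹ᵁ (g ⁻¹ᵁ V) ≤ (p₁ ≫ g) ⁻¹ᵁ V) m := by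
  rw [pullbackComp_hom_app_unitSection]
  rfl

/-- **The second coface of a pulled-back section**: `p₂^*(η_g(m))|_{U₂} = η_{p₁ ≫ g}(m)|_{U₂}` in `(p₁ ≫ g)^*M` (through
`pullbackCongr (p₂ ≫ g = p₁ ≫ g)`; ★ `pullbackComp_hom_app_unitSection`, ★ `pullbackCongr_hom_app_unitSection`).  With
`cofaceFst_unitSection`: the two cofaces AGREE on pulled-back sections (the easy half of the equaliser). [cite: StacksProject, Tag 023M] -/
theorem cofaceSnd_unitSection (H : p₂ ≫ g = p₁ ≫ g) (m : Γ(M, V)) :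
    ((Scheme.Modules.pullback (p₁ ≫ g)).obj M).presheaf.map
        (homOfLE (inf_le_right : p₁ ⁻¹ᵁ (g ⁻¹ᵁ V) ⊓ p₂ ⁻¹ᵁ (g ⁻¹ᵁ V) ≤ p₂ ⁻¹ᵁ (g ⁻¹ᵁ V))).op
        (((Scheme.Modules.pullbackCongr H).hom.app M).app (p₂ ⁻¹ᵁ (g ⁻¹ᵁ V))
          (((Scheme.Modules.pullbackComp p₂ g).hom.app M).app (p₂ ⁻¹ᵁ (g ⁻¹ᵁ V))
            (unitSection p₂ ((Scheme.Modules.pullback g).obj M) (g ⁻¹ᵁ V) (unitSection g M V m)))) =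
      unitSectionLE (p₁ ≫ g) M (inf_le_left : p₁ ⁻¹ᵁ (g ⁻¹ᵁ V) ⊓ p₂ ⁻¹ᵁ (g ⁻¹ᵁ V) ≤ (p₁ ≫ g) ⁻¹ᵁ V) m := by
  rw [pullbackComp_hom_app_unitSection]
  erw [pullbackCongr_hom_app_unitSection M H V m]
  rw [unitSectionLE]
  change (((Scheme.Modules.pullback (p₁ ≫ g)).obj M).presheaf.map _ ≫
    ((Scheme.Modules.pullback (p₁ ≫ g)).obj M).presheaf.map _) _ = _
  rw [← Functor.map_comp, ← op_comp]
  exact presheaf_map_congr _ _ _ _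

/-- **`η : Γ(V, M) → Γ(g⁻¹V, g^*M)` is injective on an affine chart** (`g` flat surjective, `V`, `g⁻¹V` affine, `M` quasi-coherent):
`Γ(g⁻¹V, g^*M)` is the base change of `Γ(V, M)` along the faithfully flat `Γ(V) → Γ(g⁻¹V)` (★ `isBaseChange_unitSectionLE`,
`faithfullyFlat_appLE`, ★ `injective_of_isBaseChange`). [cite: StacksProject, Tag 023M] [cite: GortzWedhorn2020, Thm. 14.66] -/
theorem unitSection_injective_of_affine [Flat g] [Surjective g] [M.IsQuasicoherent] (hV : IsAffineOpen V)
    (hU : IsAffineOpen (g ⁻¹ᵁ V)) : Function.Injective (unitSection g M V) := by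
  have hM : IsAffineLocalizing M := IsAffineLocalizing.of_isQuasicoherent M
  letI := (g.appLE V (g ⁻¹ᵁ V) le_rfl).hom.toAlgebra
  letI : Module Γ(X, V) Γ((Scheme.Modules.pullback g).obj M, g ⁻¹ᵁ V) :=
    Module.compHom _ (g.appLE V (g ⁻¹ᵁ V) le_rfl).hom
  haveI : IsScalarTower Γ(X, V) Γ(Z, g ⁻¹ᵁ V) Γ((Scheme.Modules.pullback g).obj M, g ⁻¹ᵁ V) :=
    ⟨fun a b x => mul_smul ((g.appLE V (g ⁻¹ᵁ V) le_rfl).hom a) b x⟩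
  have hj := isBaseChange_unitSectionLE g M (le_rfl : g ⁻¹ᵁ V ≤ g ⁻¹ᵁ V) hV hU hM
  haveI : Module.FaithfullyFlat Γ(X, V) Γ(Z, g ⁻¹ᵁ V) := faithfullyFlat_appLE g hV hU
  intro m m' h
  refine injective_of_isBaseChange (unitSectionLEₗ g M (le_rfl : g ⁻¹ᵁ V ≤ g ⁻¹ᵁ V)) hj ?_
  rw [unitSectionLEₗ_apply, unitSectionLEₗ_apply, unitSectionLE, unitSectionLE, presheaf_map_le_rfl, presheaf_map_le_rfl]
  exact h

/-- **Descent of sections on an affine chart.**  Let `g : Z → X` be flat and surjective, `p₁, p₂ : Z₂ ⇉ Z` a kernel pair of `g`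
(`IsPullback p₁ p₂ g g`), `M` a quasi-coherent `𝒪_X`-module, `V ⊆ X` an affine open with `U = g⁻¹V` and `U₂ = p₁⁻¹U ∩ p₂⁻¹U`
affine.  A section `s ∈ Γ(U, g^*M)` whose two pull-backs `p₁^*s|_{U₂}`, `p₂^*s|_{U₂} ∈ Γ(U₂, (p₁ ≫ g)^*M)` agree (the second read in
`(p₁ ≫ g)^*M` through `pullbackCongr`) is `η(m)` for a UNIQUE `m ∈ Γ(V, M)` — Amitsur's degree-zero exactness (★
`RingTheory/Flat/AmitsurDescentData`) for the faithfully flat `Γ(V) → Γ(U)` (`faithfullyFlat_appLE`), `Γ(U₂) = Γ(U) ⊗_{Γ(V)} Γ(U)`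
(`exists_ringEquiv_tensorProduct_kernelPair`) and `Γ(U, g^*M) = Γ(U) ⊗_{Γ(V)} Γ(V, M)`, `Γ(U₂, (p₁ ≫ g)^*M) = Γ(U₂) ⊗_{Γ(V)} Γ(V, M)` (★
`isBaseChange_unitSectionLE`). [cite: SGA1, Exp. VIII Thm. 1.1 and Cor. 1.2] [cite: StacksProject, Tag 023M]
[cite: GortzWedhorn2020, Thm. 14.66] -/
theorem existsUnique_unitSection_eq_of_affine [Flat g] [Surjective g] [M.IsQuasicoherent] (H₂ : IsPullback p₁ p₂ g g)
    (hV : IsAffineOpen V) (hU : IsAffineOpen (g ⁻¹ᵁ V)) (hU₂ : IsAffineOpen (p₁ ⁻¹ᵁ (g ⁻¹ᵁ V) ⊓ p₂ ⁻¹ᵁ (g ⁻¹ᵁ V)))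
    (s : Γ((Scheme.Modules.pullback g).obj M, g ⁻¹ᵁ V))
    (hs : ((Scheme.Modules.pullback (p₁ ≫ g)).obj M).presheaf.map
        (homOfLE (inf_le_left : p₁ ⁻¹ᵁ (g ⁻¹ᵁ V) ⊓ p₂ ⁻¹ᵁ (g ⁻¹ᵁ V) ≤ p₁ ⁻¹ᵁ (g ⁻¹ᵁ V))).op
        (((Scheme.Modules.pullbackComp p₁ g).hom.app M).app (p₁ ⁻¹ᵁ (g ⁻¹ᵁ V))
          (unitSection p₁ ((Scheme.Modules.pullback g).obj M) (g ⁻¹ᵁ V) s)) =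
      ((Scheme.Modules.pullback (p₁ ≫ g)).obj M).presheaf.map
        (homOfLE (inf_le_right : p₁ ⁻¹ᵁ (g ⁻¹ᵁ V) ⊓ p₂ ⁻¹ᵁ (g ⁻¹ᵁ V) ≤ p₂ ⁻¹ᵁ (g ⁻¹ᵁ V))).op
        (((Scheme.Modules.pullbackCongr H₂.w.symm).hom.app M).app (p₂ ⁻¹ᵁ (g ⁻¹ᵁ V))
          (((Scheme.Modules.pullbackComp p₂ g).hom.app M).app (p₂ ⁻¹ᵁ (g ⁻¹ᵁ V))
            (unitSection p₂ ((Scheme.Modules.pullback g).obj M) (g ⁻¹ᵁ V) s)))) :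
    ∃! m : Γ(M, V), unitSection g M V m = s := by
  have hM : IsAffineLocalizing M := IsAffineLocalizing.of_isQuasicoherent M
  -- the chart rings `R = Γ(V) → S = Γ(U)`, `R → S₂ = Γ(U₂)` and the module structures on the sections
  letI := (g.appLE V (g ⁻¹ᵁ V) le_rfl).hom.toAlgebra
  letI : Module Γ(X, V) Γ((Scheme.Modules.pullback g).obj M, g ⁻¹ᵁ V) :=
    Module.compHom _ (g.appLE V (g ⁻¹ᵁ V) le_rfl).hom
  haveI : IsScalarTower Γ(X, V) Γ(Z, g ⁻¹ᵁ V) Γ((Scheme.Modules.pullback g).obj M, g ⁻¹ᵁ V) :=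
    ⟨fun a b x => mul_smul ((g.appLE V (g ⁻¹ᵁ V) le_rfl).hom a) b x⟩
  letI := ((p₁ ≫ g).appLE V (p₁ ⁻¹ᵁ (g ⁻¹ᵁ V) ⊓ p₂ ⁻¹ᵁ (g ⁻¹ᵁ V)) inf_le_left).hom.toAlgebra
  letI : Module Γ(X, V) Γ((Scheme.Modules.pullback (p₁ ≫ g)).obj M, p₁ ⁻¹ᵁ (g ⁻¹ᵁ V) ⊓ p₂ ⁻¹ᵁ (g ⁻¹ᵁ V)) :=
    Module.compHom _ ((p₁ ≫ g).appLE V (p₁ ⁻¹ᵁ (g ⁻¹ᵁ V) ⊓ p₂ ⁻¹ᵁ (g ⁻¹ᵁ V)) inf_le_left).hom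
  haveI : IsScalarTower Γ(X, V) Γ(Z₂, p₁ ⁻¹ᵁ (g ⁻¹ᵁ V) ⊓ p₂ ⁻¹ᵁ (g ⁻¹ᵁ V))
      Γ((Scheme.Modules.pullback (p₁ ≫ g)).obj M, p₁ ⁻¹ᵁ (g ⁻¹ᵁ V) ⊓ p₂ ⁻¹ᵁ (g ⁻¹ᵁ V)) :=
    ⟨fun a b x => mul_smul (((p₁ ≫ g).appLE V (p₁ ⁻¹ᵁ (g ⁻¹ᵁ V) ⊓ p₂ ⁻¹ᵁ (g ⁻¹ᵁ V)) inf_le_left).hom a) b x⟩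
  have hj := isBaseChange_unitSectionLE g M (le_rfl : g ⁻¹ᵁ V ≤ g ⁻¹ᵁ V) hV hU hM
  have hj₂ := isBaseChange_unitSectionLE (p₁ ≫ g) M
    (inf_le_left : p₁ ⁻¹ᵁ (g ⁻¹ᵁ V) ⊓ p₂ ⁻¹ᵁ (g ⁻¹ᵁ V) ≤ (p₁ ≫ g) ⁻¹ᵁ V) hV hU₂ hM
  haveI : Module.FaithfullyFlat Γ(X, V) Γ(Z, g ⁻¹ᵁ V) := faithfullyFlat_appLE g hV hU
  -- the two coprojections as `Γ(V)`-algebra maps, and `Γ(U₂) = Γ(U) ⊗ Γ(U)`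
  have hc₂ : (p₂ ≫ g).appLE V (p₁ ⁻¹ᵁ (g ⁻¹ᵁ V) ⊓ p₂ ⁻¹ᵁ (g ⁻¹ᵁ V))
      (inf_le_right : p₁ ⁻¹ᵁ (g ⁻¹ᵁ V) ⊓ p₂ ⁻¹ᵁ (g ⁻¹ᵁ V) ≤ (p₂ ≫ g) ⁻¹ᵁ V) =
      (p₁ ≫ g).appLE V (p₁ ⁻¹ᵁ (g ⁻¹ᵁ V) ⊓ p₂ ⁻¹ᵁ (g ⁻¹ᵁ V)) inf_le_left :=
    appLE_congr_hom_of_eq H₂.w.symm V _ _ _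
  -- `η(m)|_{le_rfl} = η(m)`
  have key : ∀ n : Γ(M, V), unitSectionLEₗ g M (le_rfl : g ⁻¹ᵁ V ≤ g ⁻¹ᵁ V) n = unitSection g M V n := fun n =>
    (unitSectionLEₗ_apply g M _ n).trans (presheaf_map_le_rfl _ _ _)
  let ψ₁ : Γ(Z, g ⁻¹ᵁ V) →ₐ[Γ(X, V)] Γ(Z₂, p₁ ⁻¹ᵁ (g ⁻¹ᵁ V) ⊓ p₂ ⁻¹ᵁ (g ⁻¹ᵁ V)) :=
    { toRingHom := (p₁.appLE (g ⁻¹ᵁ V) (p₁ ⁻¹ᵁ (g ⁻¹ᵁ V) ⊓ p₂ ⁻¹ᵁ (g ⁻¹ᵁ V)) inf_le_left).hom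
      commutes' := fun r => by
        change (g.appLE V (g ⁻¹ᵁ V) le_rfl ≫ p₁.appLE (g ⁻¹ᵁ V) (p₁ ⁻¹ᵁ (g ⁻¹ᵁ V) ⊓ p₂ ⁻¹ᵁ (g ⁻¹ᵁ V)) inf_le_left) r =
          (p₁ ≫ g).appLE V (p₁ ⁻¹ᵁ (g ⁻¹ᵁ V) ⊓ p₂ ⁻¹ᵁ (g ⁻¹ᵁ V)) inf_le_left r
        rw [Scheme.Hom.appLE_comp_appLE] }
  let ψ₂ : Γ(Z, g ⁻¹ᵁ V) →ₐ[Γ(X, V)] Γ(Z₂, p₁ ⁻¹ᵁ (g ⁻¹ᵁ V) ⊓ p₂ ⁻¹ᵁ (g ⁻¹ᵁ V)) :=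
    { toRingHom := (p₂.appLE (g ⁻¹ᵁ V) (p₁ ⁻¹ᵁ (g ⁻¹ᵁ V) ⊓ p₂ ⁻¹ᵁ (g ⁻¹ᵁ V)) inf_le_right).hom
      commutes' := fun r => by
        change (g.appLE V (g ⁻¹ᵁ V) le_rfl ≫ p₂.appLE (g ⁻¹ᵁ V) (p₁ ⁻¹ᵁ (g ⁻¹ᵁ V) ⊓ p₂ ⁻¹ᵁ (g ⁻¹ᵁ V)) inf_le_right) r =
          (p₁ ≫ g).appLE V (p₁ ⁻¹ᵁ (g ⁻¹ᵁ V) ⊓ p₂ ⁻¹ᵁ (g ⁻¹ᵁ V)) inf_le_left r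
        rw [Scheme.Hom.appLE_comp_appLE, ← hc₂] }
  obtain ⟨e, he₁, he₂⟩ := exists_ringEquiv_tensorProduct_kernelPair g p₁ p₂ H₂ hV hU
  have hlift : ∀ x, Algebra.TensorProduct.lift ψ₁ ψ₂ (fun _ _ => Commute.all _ _) x = e x := by
    intro x
    induction x using TensorProduct.induction_on with
    | zero => simp
    | tmul a b =>
        have hab : a ⊗ₜ[Γ(X, V)] b = (a ⊗ₜ[Γ(X, V)] 1) * (1 ⊗ₜ[Γ(X, V)] b) := by
          rw [Algebra.TensorProduct.tmul_mul_tmul, mul_one, one_mul]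
        rw [Algebra.TensorProduct.lift_tmul, hab, map_mul, he₁, he₂]
        rfl
    | add x y hx hy => rw [map_add, map_add, hx, hy]
  have hψ : Function.Bijective (Algebra.TensorProduct.lift ψ₁ ψ₂ (fun _ _ => Commute.all _ _)) := by
    rw [show ⇑(Algebra.TensorProduct.lift ψ₁ ψ₂ (fun _ _ => Commute.all _ _)) = ⇑e from funext hlift]
    exact e.bijective
  -- the two cofaces as additive maps
  let δ₁ : Γ((Scheme.Modules.pullback g).obj M, g ⁻¹ᵁ V) →+
      Γ((Scheme.Modules.pullback (p₁ ≫ g)).obj M, p₁ ⁻¹ᵁ (g ⁻¹ᵁ V) ⊓ p₂ ⁻¹ᵁ (g ⁻¹ᵁ V)) :=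
    { toFun := fun t => ((Scheme.Modules.pullback (p₁ ≫ g)).obj M).presheaf.map
        (homOfLE (inf_le_left : p₁ ⁻¹ᵁ (g ⁻¹ᵁ V) ⊓ p₂ ⁻¹ᵁ (g ⁻¹ᵁ V) ≤ p₁ ⁻¹ᵁ (g ⁻¹ᵁ V))).op
        (((Scheme.Modules.pullbackComp p₁ g).hom.app M).app (p₁ ⁻¹ᵁ (g ⁻¹ᵁ V))
          (unitSection p₁ ((Scheme.Modules.pullback g).obj M) (g ⁻¹ᵁ V) t))
      map_zero' := by simp only [unitSection, map_zero]
      map_add' := fun t t' => by simp only [unitSection_add, map_add] }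
  let δ₂ : Γ((Scheme.Modules.pullback g).obj M, g ⁻¹ᵁ V) →+
      Γ((Scheme.Modules.pullback (p₁ ≫ g)).obj M, p₁ ⁻¹ᵁ (g ⁻¹ᵁ V) ⊓ p₂ ⁻¹ᵁ (g ⁻¹ᵁ V)) :=
    { toFun := fun t => ((Scheme.Modules.pullback (p₁ ≫ g)).obj M).presheaf.map
        (homOfLE (inf_le_right : p₁ ⁻¹ᵁ (g ⁻¹ᵁ V) ⊓ p₂ ⁻¹ᵁ (g ⁻¹ᵁ V) ≤ p₂ ⁻¹ᵁ (g ⁻¹ᵁ V))).op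
        (((Scheme.Modules.pullbackCongr H₂.w.symm).hom.app M).app (p₂ ⁻¹ᵁ (g ⁻¹ᵁ V))
          (((Scheme.Modules.pullbackComp p₂ g).hom.app M).app (p₂ ⁻¹ᵁ (g ⁻¹ᵁ V))
            (unitSection p₂ ((Scheme.Modules.pullback g).obj M) (g ⁻¹ᵁ V) t)))
      map_zero' := by simp only [unitSection, map_zero]
      map_add' := fun t t' => by simp only [unitSection_add, map_add] }
  have hδ₁ : ∀ (c : Γ(Z, g ⁻¹ᵁ V)) (t : Γ((Scheme.Modules.pullback g).obj M, g ⁻¹ᵁ V)),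
      δ₁ (c • t) = ψ₁ c • δ₁ t := by
    intro c t
    change ((Scheme.Modules.pullback (p₁ ≫ g)).obj M).presheaf.map _ (((Scheme.Modules.pullbackComp p₁ g).hom.app M).app _
      (unitSection p₁ _ (g ⁻¹ᵁ V) (c • t))) = (p₁.appLE (g ⁻¹ᵁ V) _ inf_le_left) c • _
    rw [unitSection_smul, Scheme.Modules.Hom.app_smul, Scheme.Modules.map_smul]
    rfl
  have hδ₂ : ∀ (c : Γ(Z, g ⁻¹ᵁ V)) (t : Γ((Scheme.Modules.pullback g).obj M, g ⁻¹ᵁ V)),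
      δ₂ (c • t) = ψ₂ c • δ₂ t := by
    intro c t
    change ((Scheme.Modules.pullback (p₁ ≫ g)).obj M).presheaf.map _
      (((Scheme.Modules.pullbackCongr H₂.w.symm).hom.app M).app _ (((Scheme.Modules.pullbackComp p₂ g).hom.app M).app _
      (unitSection p₂ _ (g ⁻¹ᵁ V) (c • t)))) = (p₂.appLE (g ⁻¹ᵁ V) _ inf_le_right) c • _
    rw [unitSection_smul, Scheme.Modules.Hom.app_smul, Scheme.Modules.Hom.app_smul, Scheme.Modules.map_smul]
    rfl
  have hδ₁j : ∀ m : Γ(M, V), δ₁ (unitSectionLEₗ g M (le_rfl : g ⁻¹ᵁ V ≤ g ⁻¹ᵁ V) m) =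
      unitSectionLEₗ (p₁ ≫ g) M (inf_le_left : p₁ ⁻¹ᵁ (g ⁻¹ᵁ V) ⊓ p₂ ⁻¹ᵁ (g ⁻¹ᵁ V) ≤ (p₁ ≫ g) ⁻¹ᵁ V) m := by
    intro m
    rw [key m]
    exact cofaceFst_unitSection g p₁ p₂ M m
  have hδ₂j : ∀ m : Γ(M, V), δ₂ (unitSectionLEₗ g M (le_rfl : g ⁻¹ᵁ V ≤ g ⁻¹ᵁ V) m) =
      unitSectionLEₗ (p₁ ≫ g) M (inf_le_left : p₁ ⁻¹ᵁ (g ⁻¹ᵁ V) ⊓ p₂ ⁻¹ᵁ (g ⁻¹ᵁ V) ≤ (p₁ ≫ g) ⁻¹ᵁ V) m := by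
    intro m
    rw [key m]
    exact cofaceSnd_unitSection g p₁ p₂ M H₂.w.symm m
  -- Amitsur
  obtain ⟨m, hm, huniq⟩ := existsUnique_of_isBaseChange ψ₁ ψ₂ (unitSectionLEₗ g M (le_rfl : g ⁻¹ᵁ V ≤ g ⁻¹ᵁ V))
    (unitSectionLEₗ (p₁ ≫ g) M (inf_le_left : p₁ ⁻¹ᵁ (g ⁻¹ᵁ V) ⊓ p₂ ⁻¹ᵁ (g ⁻¹ᵁ V) ≤ (p₁ ≫ g) ⁻¹ᵁ V))
    δ₁ δ₂ hj hj₂ hψ hδ₁ hδ₂ hδ₁j hδ₂j s hs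
  exact ⟨m, (key m).symm.trans hm, fun m' hm' => huniq m' ((key m').trans hm')⟩

end Chart

end Literature.AlgebraicGeometry.Morphisms

end
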